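import Mathlib
import HarnessLib
import Summits.HubbardSuperconductivity.HubbardSuperconductivity.Theorems.KLProgrammeKLRegimeTwoVolumeLipDiffDefs
import Summits.HubbardSuperconductivity.HubbardSuperconductivity.Theorems.KLProgrammeKLRegimeTwoVolumeLipJumpDefs
import Summits.HubbardSuperconductivity.HubbardSuperconductivity.Theorems.KLProgrammeKLRegimeTwoVolumeTowerDefs
import Summits.HubbardSuperconductivity.HubbardSuperconductivity.Theorems.KLProgrammeKLRegimeTwoVolumeTowerSpineDefs

/-!
# Route `KLProgramme` — crux K3 ENGINE (stmt-HubbardSuperconductivity-20437), stub (e) proof-input «(e)-D-ROWS», keying (A′), REKEY-D file D0: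
# THE OBJECTS OF THE DOUBLED-LABEL (plain-track) TWO-VOLUME LIPSCHITZ TOWER (definitions; seat hubbard-kl-k3c4-p1 g27; design map HOME/hubbard-kl-k3c4-p1/REKEY-D.md,
# pen (R495)(C)(2)/(R520)(A)(4); `--supports` 23356)

The common-frame Lipschitz tower of record (`…TwoVolumeLipLawOfRowsBase1Boot`, objects `…TwoVolumeLip{Tower,Diff,Defect,Jump}Defs`) is keyed on the SECTOR labels
`SpaceTimeIdx V M × SectorLeg (sectorCount J)`; the VL read-out `hdualSp` reads the RAW two-leg kernel (plain legs), invisible to a sector-keyed tower (located #6 (a)).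
The re-key carries the tower on the DOUBLED labels `SrcLabel V M J = (SpaceTimeIdx V M × SectorLeg (sectorCount J)) × Fin 2` of `…TwoVolumeSourceProfileDefs`
(copy `0` = alive, analysed by `ε•E(F_J)`; copy `1` = plain space-time leg in sector slot `0`, analysed by `ε•E(1)`): the analysis is E1/k3c5-p3's `klSrcAnalysisAt`
(the doubled rows of ✓ `…TwoVolumeDoubledTowerStep`), every Gaussian step uses the SPECTATOR lift `C ⊕ 0` of the sector covariance, every re-analysis the block
substitution `T ⊕ (plain slot shift)`.  This file NAMES the blocked objects, mirroring the sector-keyed Defs files one-to-one (suffix `D`):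

* §1 one volume: **`klLipInputD`** (`= map (toLin' (ε • klSrcAnalysisAt … (dk−1))) 𝒱_{dk}` — the per-scale `klTowerD` of `…TwoVolumeTowerDefs` at the block boundaries),
  **`klLipBornD`**, the spectator covariance **`klLipCovD`** (pattern of `klStepCovD`), the plain slot shift **`klPlainShift`** (`klSlotShift` at general sector counts,
  `klSlotShift_eq_klPlainShift`), the doubled transfer **`klLipTransferD`** and jumps **`klJumpD`** (pattern of `klSrcTransfer`), the plain analysis block `klPlainAnalysis`;
* §2 two volumes over the doubled block structure `klBlockEquivD` (✓ `…TwoVolumeTowerSpineDefs`): **`klBlockEmbD`**, **`klGlueD`**, **`klCopiesCovD`**, the differences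
  **`klLipInputDiffD`**, **`klLipBornDiffD`**, the covariance defect **`klLipDefectD`**, the deep pins `klDeepPinsD` (deep = the position is deep, either copy) and the
  SOURCE-GRADED deep sups **`klLipInputDiffSupD … m s R`**, **`klLipBornDiffSupD … m s R`** (`s` = number of plain legs, `srcCount`);
* §3 `rfl`/unfolding rows, and the three SHAPE rows that plug the objects into the generic doubled-tower lemmas: `klLipCovD_apply` (the `hC′` of
  `effAction_spectatorCov_map_doubleRows`), `klLipTransferD_apply`/`klJumpD_apply` (the `hTp` of `doubleBlock_mul_doubleRows`), `smul_klSrcAnalysisAt_apply` (the `hM`);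
  `klBlockEmbD_apply`, `kernel_klGlueD`, `sum_pinned_norm_kernel_klGlueD_eq` (copies lemmas of `Lit/GrassmannEffectiveActionCopies` / `…TwoVolumeGluedProfiles`).

Definitions with bodies and `rfl`/bookkeeping rows only; nothing about the model is asserted; nothing asserts the (D) rows, (e), VL, K3 or superconductivity.
References: BGM 2006 §2.7 (2.70)–(2.71), §2.9 (4.3)–(4.8), §3 (3.2)–(3.8) [cite: BenfattoGiulianiMastropietro2006]; Salmhofer 1999 App. B.2 (B.23)–(B.25).
-/

noncomputable section

namespace Summit.HubbardSuperconductivity.HubbardSuperconductivity.Theorems.TwoVolumeLip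

set_option linter.dupNamespace false -- summit = problem name (single-conjunct summit), D-0017

open Finset Literature.MathematicalPhysics.QuantumLattice GrassmannAlgebra Literature.Probability.LatticeModels
open Literature.MathematicalPhysics.QuantumLattice.FermiRG
open Summit.HubbardSuperconductivity.HubbardSuperconductivity.Theorems.KLRegimeSplit
open Summit.HubbardSuperconductivity.HubbardSuperconductivity.Theorems.KLProgrammeLegKernels
open Summit.HubbardSuperconductivity.HubbardSuperconductivity.Theorems.EngineV8
open Summit.HubbardSuperconductivity.HubbardSuperconductivity.Theorems.TwoVolumeSource
open Summit.HubbardSuperconductivity.HubbardSuperconductivity.Theorems.TwoVolumeDefect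

/-! ## §1 One volume: the doubled analysed input / born increment, the spectator covariance, the doubled transfer -/

section OneVolume

variable (V M : ℕ) [NeZero V]

/-- **`klLipInputD V M β U μ K d k`** — the input `𝒱_{dk}[K]` of block `k` under the `ε`-scaled DOUBLED analysis of the family `F_{dk−1}`:
`map (toLin' (ε • klSrcAnalysisAt … (dk−1))) 𝒱_{dk}` on `SrcLabel V M (dk−1)` (copy `0`: `klLipInput`'s analysis; copy `1`: the plain leg in sector slot `0`). -/
def klLipInputD (β U μ : ℝ) (K : TrigPolyC4v) (d k : ℕ) : GrassmannAlgebra ℂ (SrcLabel V M (d * k - 1)) :=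
  ExteriorAlgebra.map (Matrix.toLin' ((((imagTimeWeight β M : ℝ) : ℂ)) • klSrcAnalysisAt V M β μ K (d * k - 1))) (klTowerInput V M β U μ K d k)

/-- **`klLipBornD V M β U μ K d k`** — the born increment `Δ_k` of block `k` under the `ε`-scaled doubled analysis of its born family `F_{dk}`. -/
def klLipBornD (β U μ : ℝ) (K : TrigPolyC4v) (d k : ℕ) : GrassmannAlgebra ℂ (SrcLabel V M (d * k)) :=
  ExteriorAlgebra.map (Matrix.toLin' ((((imagTimeWeight β M : ℝ) : ℂ)) • klSrcAnalysisAt V M β μ K (d * k))) (klTowerIncr V M β U μ K d k)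

/-- **`klLipCovD V M β μ K d k`** — the SPECTATOR lift `C ⊕ 0` of the block covariance `klLipCov … d k` to the doubled labels (copy `0` carries the covariance,
the plain copy `1` has none). -/
def klLipCovD (β μ : ℝ) (K : TrigPolyC4v) (d k : ℕ) : Matrix (SrcLabel V M (d * k - 1)) (SrcLabel V M (d * k - 1)) ℂ :=
  Matrix.of fun p q => if p.2 = 0 ∧ q.2 = 0 then klLipCov V M β μ K d k p.1 q.1 else 0

/-- **`klPlainShift V M N′ N`** — the identity between the plain (sector slot `0`) legs at two sector counts (same site, slot `0`, same spin and charge):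
`klSlotShift` of `…TwoVolumeTowerDefs` at general `N′, N`. -/
def klPlainShift (N' N : ℕ) : Matrix (SpaceTimeIdx V M × SectorLeg N') (SpaceTimeIdx V M × SectorLeg N) ℂ :=
  Matrix.of fun Y' Y => if Y'.1 = Y.1 ∧ (Y'.2.1.1 : ℕ) = 0 ∧ (Y.2.1.1 : ℕ) = 0 ∧ Y'.2.1.2 = Y.2.1.2 ∧ Y'.2.2 = Y.2.2 then 1 else 0

/-- **`klLipTransferD V M β μ K d k`** — the doubled block transfer: `klLipTransfer … d k` on copy `0`, the plain shift on copy `1`, zero across copies. -/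
def klLipTransferD (β μ : ℝ) (K : TrigPolyC4v) (d k : ℕ) : Matrix (SrcLabel V M (d * k)) (SrcLabel V M (d * k - 1)) ℂ :=
  Matrix.of fun p' p => if p'.2 = 0 ∧ p.2 = 0 then klLipTransfer V M β μ K d k p'.1 p.1
    else if p'.2 = 1 ∧ p.2 = 1 then klPlainShift V M (sectorCount (d * k)) (sectorCount (d * k - 1)) p'.1 p.1 else 0

/-- **`klJumpD V M β μ K J′ J`** — the doubled jump: `klJump … J′ J` on copy `0`, the plain shift on copy `1`, zero across copies. -/
def klJumpD (β μ : ℝ) (K : TrigPolyC4v) (J' J : ℕ) : Matrix (SrcLabel V M J') (SrcLabel V M J) ℂ :=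
  Matrix.of fun p' p => if p'.2 = 0 ∧ p.2 = 0 then klJump V M β μ K J' J p'.1 p.1
    else if p'.2 = 1 ∧ p.2 = 1 then klPlainShift V M (sectorCount J') (sectorCount J) p'.1 p.1 else 0

/-- **`klPlainAnalysis V M β N`** — the plain analysis block (the copy-`1` rows of `klSrcAnalysisAt`): `E(1)` on sector slot `0`, zero on the other slots. -/
def klPlainAnalysis (β : ℝ) (N : ℕ) : Matrix (SpaceTimeIdx V M × SectorLeg N) (HubbardFieldIdx V M) ℂ :=
  Matrix.of fun Y X => if (Y.2.1.1 : ℕ) = 0 then sectorAnalysisMatrix V M β (trivialMultiplier V M) (Y.1, (((0 : Fin 1), Y.2.1.2), Y.2.2)) X else 0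

variable {V M}

/-- Unfolding `klLipInputD`. -/
theorem klLipInputD_def (β U μ : ℝ) (K : TrigPolyC4v) (d k : ℕ) :
    klLipInputD V M β U μ K d k =
      ExteriorAlgebra.map (Matrix.toLin' ((((imagTimeWeight β M : ℝ) : ℂ)) • klSrcAnalysisAt V M β μ K (d * k - 1))) (klTowerInput V M β U μ K d k) := rfl

/-- Unfolding `klLipBornD`. -/
theorem klLipBornD_def (β U μ : ℝ) (K : TrigPolyC4v) (d k : ℕ) :
    klLipBornD V M β U μ K d k =
      ExteriorAlgebra.map (Matrix.toLin' ((((imagTimeWeight β M : ℝ) : ℂ)) • klSrcAnalysisAt V M β μ K (d * k))) (klTowerIncr V M β U μ K d k) := rfl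

/-- `klLipInputD` as E1/k3c5-p3's doubled-analysed action `klSrcActionAt` scaled by `ε` in every leg: `kernel (klLipInputD … d k) m X = ε^m · kernel (klSrcActionAt … (dk−1) (dk)) m X`. -/
theorem kernel_klLipInputD (β U μ : ℝ) (K : TrigPolyC4v) (d k m : ℕ) (X : Fin m → SrcLabel V M (d * k - 1)) :
    kernel ℂ (klLipInputD V M β U μ K d k) m X = (((imagTimeWeight β M : ℝ) : ℂ)) ^ m * kernel ℂ (klSrcActionAt V M β U μ K (d * k - 1) (d * k)) m X := by
  rw [klLipInputD, kernel_map_toLin'_smul]; rfl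

/-- Entries of the spectator lift (the hypothesis `hC′` of `TwoVolumeDefect.effAction_spectatorCov_map_doubleRows`). -/
theorem klLipCovD_apply (β μ : ℝ) (K : TrigPolyC4v) (d k : ℕ) (p q : SrcLabel V M (d * k - 1)) :
    klLipCovD V M β μ K d k p q = if p.2 = 0 ∧ q.2 = 0 then klLipCov V M β μ K d k p.1 q.1 else 0 := rfl

omit [NeZero V] in
/-- Unfolding `klPlainShift`. -/
theorem klPlainShift_apply (N' N : ℕ) (Y' : SpaceTimeIdx V M × SectorLeg N') (Y : SpaceTimeIdx V M × SectorLeg N) :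
    klPlainShift V M N' N Y' Y = if Y'.1 = Y.1 ∧ (Y'.2.1.1 : ℕ) = 0 ∧ (Y.2.1.1 : ℕ) = 0 ∧ Y'.2.1.2 = Y.2.1.2 ∧ Y'.2.2 = Y.2.2 then 1 else 0 := rfl

omit [NeZero V] in
/-- The per-scale `klSlotShift` IS `klPlainShift` at consecutive sector counts. -/
theorem klSlotShift_eq_klPlainShift [NeZero M] (k : ℕ) : klSlotShift V M k = klPlainShift V M (sectorCount (k + 1)) (sectorCount k) := rfl

/-- Entries of the doubled transfer (the hypothesis `hTp` of `TwoVolumeDefect.doubleBlock_mul_doubleRows`). -/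
theorem klLipTransferD_apply (β μ : ℝ) (K : TrigPolyC4v) (d k : ℕ) (p' : SrcLabel V M (d * k)) (p : SrcLabel V M (d * k - 1)) :
    klLipTransferD V M β μ K d k p' p = if p'.2 = 0 ∧ p.2 = 0 then klLipTransfer V M β μ K d k p'.1 p.1
      else if p'.2 = 1 ∧ p.2 = 1 then klPlainShift V M (sectorCount (d * k)) (sectorCount (d * k - 1)) p'.1 p.1 else 0 := rfl

/-- Entries of the doubled jump (the hypothesis `hTp` of `TwoVolumeDefect.doubleBlock_mul_doubleRows`). -/
theorem klJumpD_apply (β μ : ℝ) (K : TrigPolyC4v) (J' J : ℕ) (p' : SrcLabel V M J') (p : SrcLabel V M J) :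
    klJumpD V M β μ K J' J p' p = if p'.2 = 0 ∧ p.2 = 0 then klJump V M β μ K J' J p'.1 p.1
      else if p'.2 = 1 ∧ p.2 = 1 then klPlainShift V M (sectorCount J') (sectorCount J) p'.1 p.1 else 0 := rfl

omit [NeZero V] in
/-- `klSrcAnalysisAt` IS doubled rows: alive analysis `E(F_J)` on copy `0`, `klPlainAnalysis` on copy `1`. -/
theorem klSrcAnalysisAt_apply_eq (β μ : ℝ) (K : TrigPolyC4v) (J : ℕ) (p : SrcLabel V M J) (X : HubbardFieldIdx V M) :
    klSrcAnalysisAt V M β μ K J p X =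
      if p.2 = 0 then sectorAnalysisMatrix V M β (klAnisoFamily V M β μ K klE0 J) p.1 X else klPlainAnalysis V M β (sectorCount J) p.1 X := rfl

omit [NeZero V] in
/-- The `ε`-scaled doubled analysis in the shape `hM` of the doubled-tower lemmas: `A = ε • E(F_J)`, `B = ε • klPlainAnalysis`. -/
theorem smul_klSrcAnalysisAt_apply (β μ : ℝ) (K : TrigPolyC4v) (J : ℕ) (p : SrcLabel V M J) (X : HubbardFieldIdx V M) :
    ((((imagTimeWeight β M : ℝ) : ℂ)) • klSrcAnalysisAt V M β μ K J) p X =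
      if p.2 = 0 then ((((imagTimeWeight β M : ℝ) : ℂ)) • sectorAnalysisMatrix V M β (klAnisoFamily V M β μ K klE0 J)) p.1 X
      else ((((imagTimeWeight β M : ℝ) : ℂ)) • klPlainAnalysis V M β (sectorCount J)) p.1 X := by
  simp only [Matrix.smul_apply, klSrcAnalysisAt_apply_eq]
  split_ifs <;> rfl

end OneVolume

/-! ## §2 Two volumes: glue, copies covariance, differences, defect, deep pins and the source-graded deep sups -/

section Glue

variable (L b M : ℕ) [NeZero L] [NeZero (b * L)] (n : ℕ)

/-- **`klBlockEmbD L b M n β`** — the embedding of block `β` of the doubled block structure `klBlockEquivD L b M n` (same block, same copy):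
`(klBlockEmbD … β v) X′ = [blk X′ = β] · v (res X′)`. -/
def klBlockEmbD (β : Fin 2 → Fin b) : (SrcLabel L M n → ℂ) →ₗ[ℂ] (SrcLabel (b * L) M n → ℂ) :=
  LinearMap.pi fun X' : SrcLabel (b * L) M n =>
    if (klBlockEquivD L b M n X').1 = β then (LinearMap.proj (klBlockEquivD L b M n X').2 : (SrcLabel L M n → ℂ) →ₗ[ℂ] ℂ) else 0

/-- **`klGlueD L b M n W`** — the GLUED coarse doubled element on the fine doubled labels: `Σ_β map (klBlockEmbD … β) W`. -/
def klGlueD (W : GrassmannAlgebra ℂ (SrcLabel L M n)) : GrassmannAlgebra ℂ (SrcLabel (b * L) M n) :=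
  ∑ β : Fin 2 → Fin b, ExteriorAlgebra.map (klBlockEmbD L b M n β) W

/-- **`klCopiesCovD L b M n C`** — the COPIES covariance on the fine doubled labels: `C′(X′, Y′) = [blk X′ = blk Y′] · C (res X′) (res Y′)`. -/
def klCopiesCovD (C : Matrix (SrcLabel L M n) (SrcLabel L M n) ℂ) : Matrix (SrcLabel (b * L) M n) (SrcLabel (b * L) M n) ℂ :=
  Matrix.of fun X' Y' => if (klBlockEquivD L b M n X').1 = (klBlockEquivD L b M n Y').1 then
    C (klBlockEquivD L b M n X').2 (klBlockEquivD L b M n Y').2 else 0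

variable {L b M n}

/-- The defining property of the doubled block embedding (the `hF`/`hf`/`hFe` of the copies lemmas). -/
theorem klBlockEmbD_apply (β : Fin 2 → Fin b) (v : SrcLabel L M n → ℂ) (X' : SrcLabel (b * L) M n) :
    klBlockEmbD L b M n β v X' = if (klBlockEquivD L b M n X').1 = β then v (klBlockEquivD L b M n X').2 else 0 :=
  blockEmb_pi_apply ℂ (klBlockEquivD L b M n) β v X'

/-- Unfolding `klGlueD`. -/
theorem klGlueD_def (W : GrassmannAlgebra ℂ (SrcLabel L M n)) :
    klGlueD L b M n W = ∑ β : Fin 2 → Fin b, ExteriorAlgebra.map (klBlockEmbD L b M n β) W := rfl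

/-- Unfolding `klCopiesCovD` (the `hC′` of the copies lemmas). -/
theorem klCopiesCovD_apply (C : Matrix (SrcLabel L M n) (SrcLabel L M n) ℂ) (X' Y' : SrcLabel (b * L) M n) :
    klCopiesCovD L b M n C X' Y' = if (klBlockEquivD L b M n X').1 = (klBlockEquivD L b M n Y').1 then
      C (klBlockEquivD L b M n X').2 (klBlockEquivD L b M n Y').2 else 0 := rfl

/-- The doubled glue is additive. -/
theorem klGlueD_add (W W' : GrassmannAlgebra ℂ (SrcLabel L M n)) : klGlueD L b M n (W + W') = klGlueD L b M n W + klGlueD L b M n W' := by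
  simp only [klGlueD, map_add, sum_add_distrib]

/-- The doubled glue of a difference. -/
theorem klGlueD_sub (W W' : GrassmannAlgebra ℂ (SrcLabel L M n)) : klGlueD L b M n (W - W') = klGlueD L b M n W - klGlueD L b M n W' := by
  simp only [klGlueD, map_sub, sum_sub_distrib]

/-- **Kernels of the doubled glue live in one block**: `kernel (klGlueD W) m X′ = [all legs of X′ in the block of X′_j] · kernel W m (res ∘ X′)`. -/
theorem kernel_klGlueD [NeZero M] (W : GrassmannAlgebra ℂ (SrcLabel L M n)) {m : ℕ} (j : Fin m) (X' : Fin m → SrcLabel (b * L) M n) :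
    kernel ℂ (klGlueD L b M n W) m X' =
      if ∀ i, (klBlockEquivD L b M n (X' i)).1 = (klBlockEquivD L b M n (X' j)).1 then
        kernel ℂ W m (fun i => (klBlockEquivD L b M n (X' i)).2) else 0 :=
  kernel_copies_sum (klBlockEquivD L b M n) (klBlockEmbD L b M n) klBlockEmbD_apply W j X'

/-- **The pinned profile of the doubled glue at a fine pin is that of `W` at the residue pin.** -/
theorem sum_pinned_norm_kernel_klGlueD_eq [NeZero M] (W : GrassmannAlgebra ℂ (SrcLabel L M n)) {m : ℕ} (j : Fin m) (x' : SrcLabel (b * L) M n) :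
    ∑ Y' ∈ univ.filter (fun Y' : Fin m → SrcLabel (b * L) M n => Y' j = x'), ‖kernel ℂ (klGlueD L b M n W) m Y'‖ =
      ∑ Y ∈ univ.filter (fun Y : Fin m → SrcLabel L M n => Y j = (klBlockEquivD L b M n x').2), ‖kernel ℂ W m Y‖ :=
  sum_pinned_norm_kernel_glue_eq (klBlockEquivD L b M n) (klBlockEmbD L b M n) klBlockEmbD_apply W j x'

end Glue

section Diff

variable (L b M : ℕ) [NeZero L] [NeZero (b * L)]

/-- **`klLipInputDiffD L b M β U μ K d k`** — the doubled two-volume INPUT difference of block `k` at the common frame `K`: fine doubled input minus the doubled glue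
of the coarse one. -/
def klLipInputDiffD (β U μ : ℝ) (K : TrigPolyC4v) (d k : ℕ) : GrassmannAlgebra ℂ (SrcLabel (b * L) M (d * k - 1)) :=
  klLipInputD (b * L) M β U μ K d k - klGlueD L b M (d * k - 1) (klLipInputD L M β U μ K d k)

/-- **`klLipBornDiffD L b M β U μ K d k`** — the doubled two-volume BORN difference of block `k` at the common frame `K`. -/
def klLipBornDiffD (β U μ : ℝ) (K : TrigPolyC4v) (d k : ℕ) : GrassmannAlgebra ℂ (SrcLabel (b * L) M (d * k)) :=
  klLipBornD (b * L) M β U μ K d k - klGlueD L b M (d * k) (klLipBornD L M β U μ K d k)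

/-- **`klLipDefectD L b M β μ K d k`** — the doubled covariance defect: the fine spectator covariance minus the copies of the coarse one (its plain blocks vanish). -/
def klLipDefectD (β μ : ℝ) (K : TrigPolyC4v) (d k : ℕ) : Matrix (SrcLabel (b * L) M (d * k - 1)) (SrcLabel (b * L) M (d * k - 1)) ℂ :=
  klLipCovD (b * L) M β μ K d k - klCopiesCovD L b M (d * k - 1) (klLipCovD L M β μ K d k)

variable {L b M}

/-- Unfolding `klLipInputDiffD`. -/
theorem klLipInputDiffD_def (β U μ : ℝ) (K : TrigPolyC4v) (d k : ℕ) :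
    klLipInputDiffD L b M β U μ K d k = klLipInputD (b * L) M β U μ K d k - klGlueD L b M (d * k - 1) (klLipInputD L M β U μ K d k) := rfl

/-- Unfolding `klLipBornDiffD`. -/
theorem klLipBornDiffD_def (β U μ : ℝ) (K : TrigPolyC4v) (d k : ℕ) :
    klLipBornDiffD L b M β U μ K d k = klLipBornD (b * L) M β U μ K d k - klGlueD L b M (d * k) (klLipBornD L M β U μ K d k) := rfl

/-- Unfolding `klLipDefectD`. -/
theorem klLipDefectD_def (β μ : ℝ) (K : TrigPolyC4v) (d k : ℕ) :
    klLipDefectD L b M β μ K d k = klLipCovD (b * L) M β μ K d k - klCopiesCovD L b M (d * k - 1) (klLipCovD L M β μ K d k) := rfl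

end Diff

section Deep

variable {V M : ℕ} [NeZero V] {n : ℕ}

/-- **`klDeepPinsD L R`** — the doubled labels whose POSITION is `R`-deep in its coarse block (either copy): `{x | x.1 ∈ klDeepPins L R}`. -/
def klDeepPinsD (L R : ℕ) : Finset (SrcLabel V M n) :=
  univ.filter fun x : SrcLabel V M n => x.1 ∈ klDeepPins (V := V) (M := M) (N := sectorCount n) L R

/-- Membership in `klDeepPinsD`. -/
theorem mem_klDeepPinsD {L R : ℕ} {x : SrcLabel V M n} : x ∈ klDeepPinsD (V := V) (M := M) (n := n) L R ↔ x.1 ∈ klDeepPins (N := sectorCount n) L R := by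
  simp [klDeepPinsD]

end Deep

section Sups

variable (L b M : ℕ) [NeZero L] [NeZero (b * L)]

/-- **`klLipInputDiffSupD L b M β U μ K d k m s R`** — the SOURCE-GRADED deep sup of the doubled input difference of block `k`: the supremum over slots `q < m` and `R`-deep
fine pins `w` of `Σ_{X : X q = w, srcCount X = s} ‖kernel (klLipInputDiffD … d k) m X‖` (`s` = number of plain legs; `s = 0` is the sector tower's sup). -/
def klLipInputDiffSupD (β U μ : ℝ) (K : TrigPolyC4v) (d k m s R : ℕ) : ℝ :=
  ⨆ qw : Fin m × {w : SrcLabel (b * L) M (d * k - 1) // w ∈ klDeepPinsD (V := b * L) (M := M) (n := d * k - 1) L R},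
    ∑ X ∈ univ.filter (fun X : Fin m → SrcLabel (b * L) M (d * k - 1) =>
        X qw.1 = qw.2.1 ∧ srcCount (fun Y : SrcLabel (b * L) M (d * k - 1) => Y.2 = 1) X = s),
      ‖kernel ℂ (klLipInputDiffD L b M β U μ K d k) m X‖

/-- **`klLipBornDiffSupD L b M β U μ K d k m s R`** — the source-graded deep sup of the doubled BORN difference of block `k`. -/
def klLipBornDiffSupD (β U μ : ℝ) (K : TrigPolyC4v) (d k m s R : ℕ) : ℝ :=
  ⨆ qw : Fin m × {w : SrcLabel (b * L) M (d * k) // w ∈ klDeepPinsD (V := b * L) (M := M) (n := d * k) L R},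
    ∑ X ∈ univ.filter (fun X : Fin m → SrcLabel (b * L) M (d * k) =>
        X qw.1 = qw.2.1 ∧ srcCount (fun Y : SrcLabel (b * L) M (d * k) => Y.2 = 1) X = s),
      ‖kernel ℂ (klLipBornDiffD L b M β U μ K d k) m X‖

variable {L b M}

/-- Unfolding `klLipInputDiffSupD`. -/
theorem klLipInputDiffSupD_def (β U μ : ℝ) (K : TrigPolyC4v) (d k m s R : ℕ) :
    klLipInputDiffSupD L b M β U μ K d k m s R =
      ⨆ qw : Fin m × {w : SrcLabel (b * L) M (d * k - 1) // w ∈ klDeepPinsD (V := b * L) (M := M) (n := d * k - 1) L R},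
        ∑ X ∈ univ.filter (fun X : Fin m → SrcLabel (b * L) M (d * k - 1) =>
            X qw.1 = qw.2.1 ∧ srcCount (fun Y : SrcLabel (b * L) M (d * k - 1) => Y.2 = 1) X = s),
          ‖kernel ℂ (klLipInputDiffD L b M β U μ K d k) m X‖ := rfl

/-- Unfolding `klLipBornDiffSupD`. -/
theorem klLipBornDiffSupD_def (β U μ : ℝ) (K : TrigPolyC4v) (d k m s R : ℕ) :
    klLipBornDiffSupD L b M β U μ K d k m s R =
      ⨆ qw : Fin m × {w : SrcLabel (b * L) M (d * k) // w ∈ klDeepPinsD (V := b * L) (M := M) (n := d * k) L R},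
        ∑ X ∈ univ.filter (fun X : Fin m → SrcLabel (b * L) M (d * k) =>
            X qw.1 = qw.2.1 ∧ srcCount (fun Y : SrcLabel (b * L) M (d * k) => Y.2 = 1) X = s),
          ‖kernel ℂ (klLipBornDiffD L b M β U μ K d k) m X‖ := rfl

/-- Every pinned source-graded profile at a deep pin is below the sup (input). -/
theorem sum_le_klLipInputDiffSupD [NeZero M] (β U μ : ℝ) (K : TrigPolyC4v) (d k m s R : ℕ) (q : Fin m)
    {w : SrcLabel (b * L) M (d * k - 1)} (hw : w ∈ klDeepPinsD (V := b * L) (M := M) (n := d * k - 1) L R) :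
    ∑ X ∈ univ.filter (fun X : Fin m → SrcLabel (b * L) M (d * k - 1) =>
        X q = w ∧ srcCount (fun Y : SrcLabel (b * L) M (d * k - 1) => Y.2 = 1) X = s),
      ‖kernel ℂ (klLipInputDiffD L b M β U μ K d k) m X‖ ≤ klLipInputDiffSupD L b M β U μ K d k m s R :=
  le_ciSup (f := fun qw : Fin m × {w : SrcLabel (b * L) M (d * k - 1) // w ∈ klDeepPinsD (V := b * L) (M := M) (n := d * k - 1) L R} =>
    ∑ X ∈ univ.filter (fun X : Fin m → SrcLabel (b * L) M (d * k - 1) =>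
        X qw.1 = qw.2.1 ∧ srcCount (fun Y : SrcLabel (b * L) M (d * k - 1) => Y.2 = 1) X = s),
      ‖kernel ℂ (klLipInputDiffD L b M β U μ K d k) m X‖) (Finite.bddAbove_range _) (q, ⟨w, hw⟩)

/-- Every pinned source-graded profile at a deep pin is below the sup (born). -/
theorem sum_le_klLipBornDiffSupD [NeZero M] (β U μ : ℝ) (K : TrigPolyC4v) (d k m s R : ℕ) (q : Fin m)
    {w : SrcLabel (b * L) M (d * k)} (hw : w ∈ klDeepPinsD (V := b * L) (M := M) (n := d * k) L R) :
    ∑ X ∈ univ.filter (fun X : Fin m → SrcLabel (b * L) M (d * k) =>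
        X q = w ∧ srcCount (fun Y : SrcLabel (b * L) M (d * k) => Y.2 = 1) X = s),
      ‖kernel ℂ (klLipBornDiffD L b M β U μ K d k) m X‖ ≤ klLipBornDiffSupD L b M β U μ K d k m s R :=
  le_ciSup (f := fun qw : Fin m × {w : SrcLabel (b * L) M (d * k) // w ∈ klDeepPinsD (V := b * L) (M := M) (n := d * k) L R} =>
    ∑ X ∈ univ.filter (fun X : Fin m → SrcLabel (b * L) M (d * k) =>
        X qw.1 = qw.2.1 ∧ srcCount (fun Y : SrcLabel (b * L) M (d * k) => Y.2 = 1) X = s),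
      ‖kernel ℂ (klLipBornDiffD L b M β U μ K d k) m X‖) (Finite.bddAbove_range _) (q, ⟨w, hw⟩)

/-- The graded sups are nonnegative (input). -/
theorem klLipInputDiffSupD_nonneg (β U μ : ℝ) (K : TrigPolyC4v) (d k m s R : ℕ) : 0 ≤ klLipInputDiffSupD L b M β U μ K d k m s R := by
  rw [klLipInputDiffSupD]
  rcases isEmpty_or_nonempty (Fin m × {w : SrcLabel (b * L) M (d * k - 1) // w ∈ klDeepPinsD (V := b * L) (M := M) (n := d * k - 1) L R}) with h | h
  · rw [Real.iSup_of_isEmpty]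
  · exact Real.iSup_nonneg fun _ => sum_nonneg fun _ _ => norm_nonneg _

/-- The graded sups are nonnegative (born). -/
theorem klLipBornDiffSupD_nonneg (β U μ : ℝ) (K : TrigPolyC4v) (d k m s R : ℕ) : 0 ≤ klLipBornDiffSupD L b M β U μ K d k m s R := by
  rw [klLipBornDiffSupD]
  rcases isEmpty_or_nonempty (Fin m × {w : SrcLabel (b * L) M (d * k) // w ∈ klDeepPinsD (V := b * L) (M := M) (n := d * k) L R}) with h | h
  · rw [Real.iSup_of_isEmpty]
  · exact Real.iSup_nonneg fun _ => sum_nonneg fun _ _ => norm_nonneg _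

end Sups

end Summit.HubbardSuperconductivity.HubbardSuperconductivity.Theorems.TwoVolumeLip

end
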